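import Mathlib
import Summits.NavierStokesRegularity.NavierStokesRegularity.Theorems.FrozenSignCascadeEnvelopeBoundSummitEquivalence
import Summits.NavierStokesRegularity.NavierStokesRegularity.Theorems.FrozenSignCascadeBoundedEnvelopeContinuationOfNoLocalTypeI
import HarnessLib

/-!
# Route FrozenSignCascade · crux `EnvelopeBound` (stmt-NavierStokesRegularity-1549):
# calibration of leaf (A) against Type-I exclusion

Lead c7 of the crux chain (2026-08-17). This file composes two ACCEPTED tree results and records the
sharpest available position of the crux (A) = `FrozenSignCascade.EnvelopeBound` in the programme's
partial order:

* lead c6: `SummitEquivalence.envelopeBound_iff_navierStokesRegularity (hB)` — given the sibling leaf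
  (B) = `BoundedEnvelopeContinuation`, (A) is equivalent to the summit (and unconditionally the summit
  implies (A));
* B-lead: `BoundedEnvelope.boundedEnvelopeContinuation_of_not_localTypeISingularityExists` — (B) holds
  as soon as no suitable weak solution has a local Type I singular point
  (`¬ Literature.Analysis.FluidPDE.LocalTypeISingularityExists`, Albritton–Barker 2019, Thm. 1.1; the
  registered conjecture-flagged statement used across the summit, = item
  `StretchingWellBinding.NoLocalTypeISingularity`, stmt-NavierStokesRegularity-10480).

**Consequence (`envelopeBound_iff_navierStokesRegularity_of_not_localTypeISingularityExists`).**
Modulo Type-I exclusion, the crux (A) IS the Millennium statement: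
`¬ LocalTypeISingularityExists → (EnvelopeBound ↔ NavierStokesRegularity)`, and likewise
`EnvelopeBound ↔ TypeIliouvilleThesis` (stmt-0054) and `EnvelopeBound ↔ (∀ Clay data, katoMaximalTime = ⊤)`.
Read contrapositively this is the exact content of (A): a bounded critical Fourier envelope
`sup_ξ ‖ξ‖²‖û(t,ξ)‖ ≤ C` up to a blow-up time places the flow in the critical Morrey class, where every
singularity is Type I (B-lead's `stub_morreyOfEnvelope` + Seregin–Šverák zoom); so (A) = "every
finite-time singularity of a Clay datum is envelope-riding, hence Type I in the scale-invariant-energy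
sense" — the `PM²` form of "no Type II blow-up". Together with Type-I exclusion it closes the summit
(`navierStokesRegularity_of_envelopeBound_of_not_localTypeISingularityExists`): the pair
{stmt-1549 (A), stmt-10480} dominates route FrozenSignCascade exactly as {stmt-0056, stmt-10661} does
(c6's `frozenSignCascade_hypotheses_of_typeILiouville_cruxes`).

All proofs are one-line compositions; axioms propext / Classical.choice / Quot.sound.

References: D. Albritton, T. Barker, Arch. Ration. Mech. Anal. 232 (2019), Thm. 1.1, Lemma 2.6;
G. Koch, N. Nadirashvili, G. Seregin, V. Šverák, Acta Math. 203 (2009), §1;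
P. G. Lemarié-Rieusset (2016), Thm. 15.1 (C).
-/

noncomputable section

set_option linter.dupNamespace false -- nested layout Summit.<S>.<Sub>, Sub = S (D-0017)

namespace Summit.NavierStokesRegularity.NavierStokesRegularity.Theorems.EnvelopeBound.SummitEquivalence

open Summit.NavierStokesRegularity.NavierStokesRegularity
open Literature.Analysis.FluidPDE

/-! ### Leaf (A) modulo Type-I exclusion -/

/-- **Modulo Type-I exclusion, the crux (A) is the summit.** If no suitable weak solution of the
unit-viscosity Navier–Stokes system has a local Type I singular point
(`¬ LocalTypeISingularityExists`), then `EnvelopeBound ↔ NavierStokesRegularity`: `→` is the route's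
deciding theorem `closes` fed with B-lead's
`boundedEnvelopeContinuation_of_not_localTypeISingularityExists`, `←` is c6's unconditional
`envelopeBound_of_navierStokesRegularity`.
[cite: AlbrittonBarker2019, Thm. 1.1 and Lemma 2.6; LemarieRieusset2016, Thm. 15.1 (C)] -/
theorem envelopeBound_iff_navierStokesRegularity_of_not_localTypeISingularityExists
    (hno : ¬ LocalTypeISingularityExists) :
    Theses.FrozenSignCascade.EnvelopeBound ↔ _root_.NavierStokesRegularity :=
  envelopeBound_iff_navierStokesRegularity
    (BoundedEnvelope.boundedEnvelopeContinuation_of_not_localTypeISingularityExists hno)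

/-- **Modulo Type-I exclusion, the crux (A) is the no-blow-up item stmt-NavierStokesRegularity-0054**
(`TypeILiouville.TypeIliouvilleThesis`). [cite: AlbrittonBarker2019, Thm. 1.1 and Lemma 2.6] -/
theorem envelopeBound_iff_typeIliouvilleThesis_of_not_localTypeISingularityExists
    (hno : ¬ LocalTypeISingularityExists) :
    Theses.FrozenSignCascade.EnvelopeBound ↔ Theses.TypeILiouville.TypeIliouvilleThesis :=
  envelopeBound_iff_typeIliouvilleThesis
    (BoundedEnvelope.boundedEnvelopeContinuation_of_not_localTypeISingularityExists hno)

/-- **Modulo Type-I exclusion, the crux (A) says exactly that every Clay datum has infinite Kato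
maximal time.** [cite: AlbrittonBarker2019, Thm. 1.1; LemarieRieusset2016, Thm. 15.1 (C) with Thm. 7.2] -/
theorem envelopeBound_iff_forall_katoMaximalTime_eq_top_of_not_localTypeISingularityExists
    (hno : ¬ LocalTypeISingularityExists) :
    Theses.FrozenSignCascade.EnvelopeBound ↔
      ∀ ν : ℝ, 0 < ν → ∀ u₀ : EuclideanSpace ℝ (Fin 3) → EuclideanSpace ℝ (Fin 3),
        ContDiff ℝ (⊤ : ℕ∞) u₀ → NSWave0.IsDivFree u₀ → HasRapidSpatialDecay u₀ →
        katoMaximalTime ν u₀ = ⊤ :=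
  envelopeBound_iff_forall_katoMaximalTime_eq_top
    (BoundedEnvelope.boundedEnvelopeContinuation_of_not_localTypeISingularityExists hno)

/-! ### Cross-route domination: (A) and Type-I exclusion close the summit -/

/-- **The crux (A) together with Type-I exclusion proves the Millennium statement**: the pair
{`FrozenSignCascade.EnvelopeBound` (stmt-1549), `¬ LocalTypeISingularityExists` (= stmt-10480
`StretchingWellBinding.NoLocalTypeISingularity`)} implies `NavierStokesRegularity` — (A) supplies the
bounded critical envelope at every horizon, Type-I exclusion supplies (B).
[cite: AlbrittonBarker2019, Thm. 1.1 and Lemma 2.6; LemarieRieusset2016, Thm. 15.1 (C)] -/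
theorem navierStokesRegularity_of_envelopeBound_of_not_localTypeISingularityExists
    (hA : Theses.FrozenSignCascade.EnvelopeBound) (hno : ¬ LocalTypeISingularityExists) :
    _root_.NavierStokesRegularity :=
  Theses.FrozenSignCascade.closes hA
    (BoundedEnvelope.boundedEnvelopeContinuation_of_not_localTypeISingularityExists hno)

end Summit.NavierStokesRegularity.NavierStokesRegularity.Theorems.EnvelopeBound.SummitEquivalence

end
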